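import Literature.Probability.Percolation.ArmSeparationIntFrame
import Literature.Probability.Percolation.TriLowestCrossingPairs
import HarnessLib

/-!
# The fence of a term explored FROM ABOVE at an internal extremity (twin of `ArmSeparationFrameBelow.lean`)

Topic `Literature/Probability/Percolation`; family `crit-perc` / near-critical percolation on `𝕋`.
A brick of the INNER half of the near-critical arm-separation theorem for four arms in the ADJACENT
colour arrangement (P. Nolin, EJP 13 (2008), Thm. 11, `j = 4`, `σ = BBWW` [arXiv 0711.4948:
Thm. 10], §4.4 Lemma 15, internal extremities). The exploration of the inner half-annulus from
above is the lowest-crossing exploration of the FLIPPED domain `(intDom m).flip`; the fence of one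
of its terms `d` (tip `z` on the inner side) sits in the LOWER corner box
`[m-2k, m-k] × [z₁-2k, z₁-k]` inside `Λ_m`, and its connection runs in `flip.above d z` on the
half-annulus and strictly BELOW the row of the tip inside `Λ_m`. Word-for-word twin of
`ArmSeparationFrameBelow.lean` on the inner geometry of `ArmSeparationIntFrame.lean`:

* `intFrameZoneBelow m z k` — the mirrored inner zone;
* `int_invariant_step_below` — the closure step of the mirrored invariant along `Yr ∖ d`;
* `int_exists_fence_below_gen` — the mirrored fence stopped at a set `S ⊇ d`;
* `int_no_closed_escape_below` — protection from below for free.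

Everything here is proved; no named facts are introduced.

## References

* P. Nolin, Near-critical percolation in two dimensions, *Electron. J. Probab.* 13 (2008), §4.4
  Lemma 15 (proof), internal extremities (arXiv 0711.4948: Lemma 14; Thm. 10 p. 13) [Nolin2008].
* H. Kesten, Scaling relations for 2D-percolation, *Comm. Math. Phys.* 109 (1987), Lemma 2 [Kesten1987].
* H. Kesten, *Percolation theory for mathematicians* (1982), §2.3 [KestenPTM1982].
-/

noncomputable section

open Set

namespace Literature.Probability.Percolation

open LatticeModels HalfAnnulus

/-- **The mirrored inner zone**: sites of the half-annulus, or sites inside `Λ_m` strictly below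
the row of the tip, within the square of half-width `2k + 1` about `z`. [cite: Nolin2008, §4.4 Lemma 15 (proof), internal extremities (arXiv 0711.4948: Lemma 14)] -/
def intFrameZoneBelow (m : ℕ) (z : Site 2) (k : ℕ) : Set (Site 2) :=
  {v | (v ∈ haSet m ∨ (v ∈ hinSet m ∧ v 1 < z 1)) ∧
    z 0 - (2 * k + 1) ≤ v 0 ∧ v 0 ≤ z 0 + (2 * k + 1) ∧ z 1 - (2 * k + 1) ≤ v 1 ∧ v 1 ≤ z 1 + (2 * k + 1)}

/-- Membership in the mirrored inner zone, unfolded. [folklore] -/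
theorem mem_intFrameZoneBelow {m k : ℕ} {z v : Site 2} :
    v ∈ intFrameZoneBelow m z k ↔ (v ∈ haSet m ∨ (v ∈ hinSet m ∧ v 1 < z 1)) ∧
      z 0 - (2 * k + 1) ≤ v 0 ∧ v 0 ≤ z 0 + (2 * k + 1) ∧ z 1 - (2 * k + 1) ≤ v 1 ∧ v 1 ≤ z 1 + (2 * k + 1) :=
  Iff.rfl

section Fence

variable {m k : ℕ} {d : Finset (Site 2)} {z : Site 2}

/-- **Closure step of the mirrored invariant (internal extremity)** along a `d`-avoiding path inside
`Yr = N ∪ S ∪ E` of a frame about the tip `z` of a crossing `d` of the flipped inner domain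
(`m ≥ 5`, `1 ≤ k`, `-m + 2k + 1 ≤ z₁ ≤ -(2k+1)`): "on the half-annulus: `flip.above d z`; inside
`Λ_m`: strictly below the row of the tip" passes to the neighbours. [cite: KestenPTM1982, §2.3 (highest crosscut)] [cite: Kesten1987, Lemma 2] -/
theorem int_invariant_step_below (hm : 5 ≤ m) (hk : 1 ≤ k) (hd : (intDom m).flip.IsCrossing d z)
    (htk : -(m : ℤ) + 2 * k + 1 ≤ z 1 ∧ z 1 ≤ -(2 * (k : ℤ) + 1))
    {ω' : SiteConfig (Site 2)} (F : FrameData z k ω') {v w : Site 2} (hv : v ∈ F.Yr \ ↑d) (hw : w ∈ F.Yr \ ↑d)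
    (hadj : triGraph.Adj v w) (hvin : (m : ℤ) ≤ triNorm v → v ∈ (intDom m).flip.above d z)
    (hvout : triNorm v < m → v 1 < z 1) :
    ((m : ℤ) ≤ triNorm w → w ∈ (intDom m).flip.above d z) ∧ (triNorm w < m → w 1 < z 1) := by
  have hk' : (1 : ℤ) ≤ k := by exact_mod_cast hk
  have hd' : (intDom m).IsCrossing d z := (JDomain.flip_isCrossing_iff _).1 hd
  have hzJ := tip_isIntJ hd'
  unfold IsIntJ at hzJ
  obtain ⟨hz0, hz1, hz2⟩ := hzJ
  have hcutf : (intDom m).flip.CutProp := JDomain.flip_cutProp (intDom_cutProp hm)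
  have hYb : ∀ u ∈ F.Yr, z 0 - 2 * k ≤ u 0 ∧ u 0 ≤ z 0 + 2 * k ∧ z 1 - 2 * k ≤ u 1 ∧ u 1 ≤ z 1 + 2 * k :=
    fun u hu => F.boundsK (F.Yr_subset_K hu)
  have hYD : ∀ u ∈ F.Yr, (m : ℤ) ≤ triNorm u → u ∈ haFin m := by
    intro u hu hn
    have hb := hYb u hu
    refine mem_haFin.2 ⟨by omega, hn, ?_⟩
    rw [triNorm_eq_max]; omega
  have hYrow : ∀ u ∈ F.Yr, triNorm u < m → u 1 ≠ z 1 := by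
    intro u hu hn
    rcases hu with (hu | hu) | hu
    · have := F.boundsN hu; omega
    · have := F.boundsS hu; omega
    · have hb := F.boundsE hu
      rw [triNorm_eq_max] at hn
      omega
  have hcoord := fun {a b : Site 2} (h : triGraph.Adj a b) => (triGraph_adj_iff_coord a b).1 h
  have hwd : w ∉ d := fun h => hw.2 (Finset.mem_coe.2 h)
  have hvd : v ∉ d := fun h => hv.2 (Finset.mem_coe.2 h)
  have hwne : w ≠ z := fun h => hwd (h ▸ hd.tip_mem)
  have hvne : v ≠ z := fun h => hvd (h ▸ hd.tip_mem)
  have hwne' : ¬ (w 0 = z 0 ∧ w 1 = z 1) := fun h => hwne (Site.eq_iff_two.2 h)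
  have hvne' : ¬ (v 0 = z 0 ∧ v 1 = z 1) := fun h => hvne (Site.eq_iff_two.2 h)
  have hN1 := triNorm_le_triNorm_add_one_of_adj hadj
  have hN2 := triNorm_le_triNorm_add_one_of_adj hadj.symm
  constructor
  · intro hwn
    have hwD : w ∈ haFin m := hYD w hw.1 hwn
    by_cases hvn : (m : ℤ) ≤ triNorm v
    · exact JDomain.mem_above_of_adj (hvin hvn) hwD hwd hadj
    · rw [not_le] at hvn
      -- `w` is on the inner boundary next to an inner site below the tip row: bottom-type
      have hvrow := hvout hvn
      have hwN : triNorm w = m := by omega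
      have hvw := hcoord hadj
      have hwb := hYb w hw.1
      have hwN' := hwN
      rw [triNorm_eq_max] at hwN'
      have hw0 : w 0 = m ∧ w 1 < z 1 := by
        have hvN := hvn; rw [triNorm_eq_max] at hvN
        omega
      by_cases hj : -(m : ℤ) + 2 ≤ w 1
      · -- on the tip arc, strictly below the tip: `Jbelow z = flip.Jabove z`
        exact hd.mem_above_of_mem_Jabove (by
          rw [JDomain.flip_Jabove]
          exact JDomain.mem_Jbelow.2 ⟨mem_intDom_J.2 ⟨hwD, ⟨hw0.1, hj, by omega⟩⟩, by simpa using hw0.2⟩)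
      · -- near the lower corner: bottom-type `Bt = flip.Tp`
        exact hd.mem_above_of_mem_Tp (by
          rw [JDomain.flip_Tp]
          exact mem_intDom_Bt.2 ⟨hwD, ⟨hwN, Or.inr ⟨hw0.1, by omega⟩⟩⟩) hwd
  · intro hwn
    have hvw := hcoord hadj
    have hne := hYrow w hw.1 hwn
    by_cases hvn : (m : ℤ) ≤ triNorm v
    · -- `v` is a `flip.above` site of the inner boundary: not top-type for the original domain
      have hva := hvin hvn
      have hvD : v ∈ haFin m := hYD v hv.1 hvn
      have hvN : triNorm v = m := by omega
      have hnotTp : ¬ (v ∈ (intDom m).flip.Bt ∪ (intDom m).flip.Jbelow z) := fun h =>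
        hd.not_mem_above_of_mem_Bt_union hcutf h hva
      rw [JDomain.flip_Bt, JDomain.flip_Jbelow] at hnotTp
      have hvb := hYb v hv.1
      -- `v` lies on the tip side
      have hv0 : v 0 = m := by
        have hvN' := hvN
        have hwn' := hwn
        rw [triNorm_eq_max] at hvN' hwn'
        rcases hvw with h | h | h | h | h | h <;> omega
      have h1 : ¬ (-2 ≤ v 1) := fun h => hnotTp (Finset.mem_union_left _ (mem_intDom_Tp.2 ⟨hvD, ⟨hvN, Or.inr ⟨hv0, h⟩⟩⟩))
      have h2 : ¬ (-(m : ℤ) + 2 ≤ v 1 ∧ z 1 < v 1) := fun h =>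
        hnotTp (Finset.mem_union_right _ (JDomain.mem_Jabove.2 ⟨mem_intDom_J.2 ⟨hvD, ⟨hv0, h.1, by omega⟩⟩, by simpa using h.2⟩))
      have hv1 : v 1 < z 1 := by
        rcases lt_or_ge (v 1) (z 1) with h | h
        · exact h
        · exfalso
          rcases h.lt_or_eq with h' | h'
          · exact h2 ⟨by omega, h'⟩
          · exact hvne' ⟨hv0.trans hz0.symm, h'.symm⟩
      have hw1 : w 1 ≤ v 1 + 1 := by rcases hvw with h | h | h | h | h | h <;> omega
      omega
    · rw [not_le] at hvn
      have := hvout hvn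
      omega

/-- **The mirrored inner fence, stopped at a set `S ⊇ d`** of half-annulus sites. In `ω`: the
lower corner box `[m-2k, m-k] × [z₁-2k, z₁-k]` inside `Λ_m` is crossed vertically by open sites
through a site `mm`, and `mm` is joined to a neighbour `p` of a site `q ∈ S` by an open
`S`-avoiding path inside `intFrameZoneBelow m z k`, whose half-annulus sites lie in `flip.above d z`
and whose inner sites lie strictly below the row of `z`. [cite: Nolin2008, §4.4 Lemma 15 (proof), internal extremities (arXiv 0711.4948: Lemma 14)] [cite: Kesten1987, Lemma 2] -/
theorem int_exists_fence_below_gen (hm : 5 ≤ m) (hk : 1 ≤ k) (hd : (intDom m).flip.IsCrossing d z)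
    (htk : -(m : ℤ) + 2 * k + 1 ≤ z 1 ∧ z 1 ≤ -(2 * (k : ℤ) + 1))
    {ω ω' : SiteConfig (Site 2)} (hagree : ∀ v, v ∉ (intDom m).flip.lower d z → (v ∈ ω' ↔ v ∈ ω))
    (hframe : ω' ∈ triFrameAt z k) {S : Set (Site 2)} (hdS : (↑d : Set (Site 2)) ⊆ S) (hSn : ∀ v ∈ S, (m : ℤ) ≤ triNorm v) :
    ∃ mm : Site 2, OpenVCrossThrough (triStrip (z 0 - 2 * k) (z 1 - 2 * k) k k) (z 1 - 2 * k) (z 1 - k) ω mm ∧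
      ∃ q ∈ S, ∃ p : Site 2, triGraph.Adj q p ∧
        PathIn triGraph ((intFrameZoneBelow m z k ∩
          {v | ((m : ℤ) ≤ triNorm v → v ∈ (intDom m).flip.above d z) ∧ (triNorm v < m → v 1 < z 1)}) ∩ ω ∩ Sᶜ) p mm := by
  have hk' : (1 : ℤ) ≤ k := by exact_mod_cast hk
  have hd' : (intDom m).IsCrossing d z := (JDomain.flip_isCrossing_iff _).1 hd
  have hzJ := tip_isIntJ hd'
  unfold IsIntJ at hzJ
  obtain ⟨hz0, hz1, hz2⟩ := hzJ
  obtain ⟨F⟩ := nonempty_frameData hframe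
  -- sites off the half-annulus are off `flip.lower d z`, hence carry the same colour in `ω`, `ω'`
  have hlowD : ∀ v ∈ (intDom m).flip.lower d z, v ∈ haFin m := fun v hv => JDomain.lower_subset_D hd.subset hv
  have hinn : ∀ v : Site 2, triNorm v < m → (v ∈ ω' ↔ v ∈ ω) := by
    intro v hv
    refine hagree v fun h => ?_
    have := (mem_haFin.1 (hlowD v h)).2.1
    omega
  -- the left strip is inside the inner half-hexagon
  have hWinn : ∀ v : Site 2, z 0 - 2 * k ≤ v 0 → v 0 ≤ z 0 - k → z 1 - 2 * k ≤ v 1 → v 1 ≤ z 1 + 2 * k → triNorm v < m := by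
    intro v h1 h2 h3 h4
    rw [triNorm_eq_max]; omega
  -- the lower part of the left crossing: a vertical crossing `V'` of the lower corner box
  obtain ⟨e₁, e₂, he₁, he₂, hV⟩ := F.pathW.exists_slab_crossing 1 (L := z 1 - 2 * k) (R := z 1 - k)
    (by omega) (by rw [F.xW1]) (by rw [F.yW1]; omega)
  obtain ⟨SV, hSV, pV, tV⟩ := hV.exists_support
  have hSVb : ∀ v ∈ SV, z 0 - 2 * k ≤ v 0 ∧ v 0 ≤ z 0 - k ∧ z 1 - 2 * k ≤ v 1 ∧ v 1 ≤ z 1 - k := by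
    intro v hv
    have h1 := F.boundsW (hSV hv).1
    have h2 := (hSV hv).2
    simp only [Set.mem_setOf_eq] at h2
    omega
  have hSVω : SV ⊆ triStrip (z 0 - 2 * k) (z 1 - 2 * k) k k ∩ ω := by
    intro v hv
    have hb := hSVb v hv
    refine ⟨?_, (hinn v (hWinn v hb.1 hb.2.1 hb.2.2.1 (by omega))).1 ((F.SW_sub (hSV hv).1).2)⟩
    rw [mem_triStrip]; omega
  -- the bottom crossing meets `V'` at `mm`
  obtain ⟨mm, hmS, hmV⟩ := PathIn.tri_crossings_meet (L := z 0 - 2 * k) (R := z 0 + 2 * k)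
    (B := z 1 - 2 * k) (T := z 1 - k) (fun v hv => by have := F.boundsS hv; omega)
    (fun v hv => by have := hSVb v hv; omega) F.pathS F.xS0 F.yS0 pV he₁ he₂
  refine ⟨mm, ⟨e₁, e₂, he₁, he₂, (tV mm hmV).mono hSVω, ((tV mm hmV).symm.trans pV).mono hSVω⟩, ?_⟩
  -- `d` (hence `S`) meets `Yr`
  have hmY : mm ∈ F.Yr := Or.inl (Or.inr hmS)
  obtain ⟨f, hfd, hfF⟩ := hd'.exists_start
  have hfout : f 0 ≤ z 0 - 2 * k ∨ z 0 + 2 * k ≤ f 0 ∨ f 1 ≤ z 1 - 2 * k ∨ z 1 + 2 * k ≤ f 1 := by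
    obtain ⟨hf, hfF'⟩ := mem_intDom_F.1 hfF
    obtain ⟨hf0, -, hfN⟩ := mem_haFin.1 hf
    rcases hfF' with h | h
    · left; omega
    · rw [triNorm_eq_max] at h; omega
  obtain ⟨y, hyd, hyK⟩ := F.exists_mem_K hk (s := z) (t := f) (by omega) hfout (hd'.conn z hd'.tip_mem f hfd)
  have hyd' : y ∈ d := Finset.mem_coe.1 hyd
  have hyY : y ∈ F.Yr := by
    rcases hyK with ((hy | hy) | hy) | hy
    · exact Or.inl (Or.inl hy)
    · exact Or.inl (Or.inr hy)
    · exfalso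
      have hb := F.boundsW hy
      have h1 := (mem_haFin.1 (hd'.subset hyd')).2.1
      have h2 := hWinn y hb.1 hb.2.1 hb.2.2.1 hb.2.2.2
      omega
    · exact Or.inr hy
  -- follow `Yr` from `mm` to the first site adjacent to `S`
  have hminn : triNorm mm < m := hWinn mm (hSVb mm hmV).1 (hSVb mm hmV).2.1 (hSVb mm hmV).2.2.1 (by have := hSVb mm hmV; omega)
  have hmS' : mm ∈ Sᶜ := fun h => by have := hSn mm h; omega
  obtain ⟨p, q, hpS, hqS, hqY, hpq, hmp⟩ := (F.pathIn_Yr hk hmY hyY).exit (R := Sᶜ) hmS' (fun h => h (hdS hyd))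
  have hqS' : q ∈ S := not_not.1 hqS
  have hmp' : PathIn triGraph ((F.Yr \ ↑d) ∩ Sᶜ) mm p :=
    hmp.mono fun v hv => ⟨⟨hv.2, fun hvd => hv.1 (hdS hvd)⟩, hv.1⟩
  -- the invariant along this path
  set G : Set (Site 2) := {v | ((m : ℤ) ≤ triNorm v → v ∈ (intDom m).flip.above d z) ∧ (triNorm v < m → v 1 < z 1)} with hG
  have hmG : mm ∈ G := ⟨fun h => absurd hminn (not_lt.2 h), fun _ => by have := (hSVb mm hmV).2.2.2; omega⟩
  have hpath : PathIn triGraph (((F.Yr \ ↑d) ∩ Sᶜ) ∩ G) mm p :=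
    hmp'.inter_of_invariant hmG fun x w hx hxG hw hxw => int_invariant_step_below hm hk hd htk F hx.1 hw.1 hxw hxG.1 hxG.2
  -- sites satisfying the invariant are open sites of the zone
  have hsub : ((F.Yr \ ↑d) ∩ Sᶜ) ∩ G ⊆ (intFrameZoneBelow m z k ∩ G) ∩ ω ∩ Sᶜ := by
    rintro v ⟨⟨⟨hvY, -⟩, hvS⟩, hvin, hvout⟩
    have hb := F.boundsK (F.Yr_subset_K hvY)
    have hvω' : v ∈ ω' := F.K_subset (F.Yr_subset_K hvY)
    by_cases hvn : (m : ℤ) ≤ triNorm v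
    · have hvD : v ∈ haFin m := by
        refine mem_haFin.2 ⟨by omega, hvn, ?_⟩
        rw [triNorm_eq_max]; omega
      refine ⟨⟨⟨⟨Or.inl (by rw [← coe_haFin]; exact Finset.mem_coe.2 hvD), by omega, by omega, by omega, by omega⟩, hvin, hvout⟩, ?_⟩, hvS⟩
      have hva := hvin hvn
      have hvl : v ∉ (intDom m).flip.lower d z := fun h =>
        ((JDomain.mem_lower_iff_not_mem_above (show v ∈ (intDom m).flip.D from hvD)).1 h) hva
      exact (hagree v hvl).1 hvω'
    · rw [not_le] at hvn
      exact ⟨⟨⟨⟨Or.inr ⟨⟨by omega, hvn⟩, hvout hvn⟩, by omega, by omega, by omega, by omega⟩, hvin, hvout⟩, (hinn v hvn).1 hvω'⟩, hvS⟩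
  exact ⟨q, hqS', p, hpq.symm, (hpath.mono hsub).symm⟩

end Fence

/-! ### Protection from below -/

/-- **Protection from below, for free (internal extremity).** Let `d` be a crossing of the flipped
inner domain with tip `z`, open in `ω`; let `ω'` agree with `ω` off `flip.lower d z` and contain
the open frame at scale `k` about `z`. Then in `ω` no closed `𝕋`-path of the half-annulus goes
from a bottom-type site (`Bt ∪ J_{<z}`) inside the inner box of the frame to a site outside its
outer box. [cite: Nolin2008, §4.4 Lemma 15 (proof), internal extremities (arXiv 0711.4948: Lemma 14)] -/
theorem int_no_closed_escape_below {m k : ℕ} {d : Finset (Site 2)} {z : Site 2} (hk : 1 ≤ k)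
    (hd : (intDom m).flip.IsCrossing d z) {ω ω' : SiteConfig (Site 2)}
    (hdω : (↑d : Set (Site 2)) ⊆ ω) (hagree : ∀ v, v ∉ (intDom m).flip.lower d z → (v ∈ ω' ↔ v ∈ ω))
    (hframe : ω' ∈ triFrameAt z k) {q t : Site 2} (hq : q ∈ (intDom m).Bt ∪ (intDom m).Jbelow z)
    (hqin : z 0 - k ≤ q 0 ∧ q 0 ≤ z 0 + k ∧ z 1 - k ≤ q 1 ∧ q 1 ≤ z 1 + k)
    (ht : t 0 ≤ z 0 - 2 * k ∨ z 0 + 2 * k ≤ t 0 ∨ t 1 ≤ z 1 - 2 * k ∨ z 1 + 2 * k ≤ t 1)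
    (hpath : PathIn triGraph (haSet m ∩ ωᶜ) q t) : False := by
  obtain ⟨F⟩ := nonempty_frameData hframe
  obtain ⟨Tq, hTq, hqt, htight⟩ := hpath.exists_support
  obtain ⟨x, hxT, hxK⟩ := F.exists_mem_K hk hqin ht hqt
  have hxω' : x ∈ ω' := F.K_subset hxK
  have hxω : x ∉ ω := (hTq hxT).2
  -- `x` is frozen, closed, hence flip-below the crossing
  have hxlow : x ∈ (intDom m).flip.lower d z := by
    by_contra h
    exact hxω ((hagree x h).1 hxω')
  have hxd : x ∉ d := fun h => hxω (hdω h)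
  have hxbelow : x ∈ (intDom m).flip.below d z := by
    rcases JDomain.mem_lower.1 hxlow with h | h
    · exact absurd h hxd
    · exact h
  -- but the closed path from the bottom-type site `q` runs in `D ∖ d`, inside `flip.above`
  have hTq' : Tq ⊆ (↑((intDom m).flip.D \ d) : Set (Site 2)) := by
    intro v hv
    rw [Finset.coe_sdiff]
    refine ⟨?_, fun hvd => (hTq hv).2 (hdω hvd)⟩
    have h1 := (hTq hv).1
    rw [← coe_haFin] at h1
    exact Finset.mem_coe.1 h1
  have hqd : q ∉ d := fun h => (hTq hqt.left_mem).2 (hdω h)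
  have hqabove : q ∈ (intDom m).flip.above d z := by
    rcases Finset.mem_union.1 hq with h | h
    · exact hd.mem_above_of_mem_Tp (by rw [JDomain.flip_Tp]; exact h) hqd
    · exact hd.mem_above_of_mem_Jabove (by rw [JDomain.flip_Jabove]; exact h)
  have hxabove : x ∈ (intDom m).flip.above d z := JDomain.mem_above_of_pathIn' hqabove ((htight x hxT).mono hTq')
  exact (JDomain.mem_below.1 hxbelow).2.2 hxabove

end Literature.Probability.Percolation
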